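import Summits.CriticalPhenomena.PercolationContinuityZ3.Theorems.Transplant.FKConnectivityAllQPat3SPAllInner
import Summits.CriticalPhenomena.PercolationContinuityZ3.Theorems.Transplant.FKConnectivityAllQTsymSP
import HarnessLib

/-!
# Connectivity correlation inequalities for `φ_{w,q}`, every `q > 0` — **THEOREM SP ON EVERY TWO-TERMINAL SERIES–PARALLEL NETWORK, EVERY PLACEMENT**

Proof file (`--supports stmt-CriticalPhenomena-4575`), census lineage (gen 37) of LANE 2's FK sub-programme; builds on p205010
(kernel theorem, internal audit signed; external expert review pending).  No definitions, no named facts, no sorries.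

**`FK.spGood_of_isTTSP`** — census g34's THEOREM SP (PROOF-THEOREM-SP §1.3; internal audit census g35) for the class of
two-terminal series–parallel networks (which contains every 2-connected series–parallel simple graph), as a KERNEL theorem: for every
`FK.IsTTSP E x y` and every three pairwise distinct vertices `b, s, t` lying on edges of `E` (terminals or not), at every level,
`T_sym(b, s, t) ≥ 0` and `STAR ≥ 0` for each of the three apexes (`FK.SPGood E b s t`).  Corollaries: the weight forms
(`FK.tval_tsym_nonneg_of_isTTSP`, `FK.mval2_star_nonneg_of_isTTSP`) and **Conjecture T for every placement**
(`FK.antipodalT_nonneg_of_isTTSP_marks`: `0 ≤ antipodalT q b s t E ∅` for all pairwise distinct `b, s, t` on `E`, every `q > 0`;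
the tree had the pair = the two terminals (`FK.antipodalT_nonneg_of_isTTSP`, fk-2) and {terminal, terminal, inner} (census g36)).
PROOF (census g37): strong induction on `|E|` over the last constructor of `IsTTSP E x y`.  SERIES `F₁ ·ₘ F₂` (`FK.spGood_series`):
a mark at `m` separating the other two ⇒ `FK.spGood_cutS`; all marks on one block ⇒ `FK.spGood_oneSided` with the induction
hypothesis on that block; marks `2 | 1` with `m` unmarked ⇒ `FK.spGood_cut1` with the induction hypothesis on the two-mark block read
with `m` as its third mark.  PARALLEL ⇒ `FK.spGood_parallel` (`…Pat3SPAllInner.lean`; no induction hypothesis: THETA / RING /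
CORNER / type-I / `pb` / `pc` recursions of `…Pat3SPRecursion.lean`).  No use is made of Lemma Θ₃, THEOREM 3C, minors, Duffin's
theorem or decomposition trees; every leaf is one of census g36's kernel-checked certificate theorems.
[cite: AyyerLinussonRavichandran2025, §7 (p. 22)] [cite: Grimmett2006, §3.8 (pp. 61–62)]
-/

namespace Summit.CriticalPhenomena.PercolationContinuityZ3.Theorems

namespace FK

open SimpleGraph Literature.Probability.LatticeModels Literature.Probability.Percolation
open scoped Classical

variable {V : Type*} [Fintype V]

/-! ### The series case (uses the induction hypothesis on the blocks) -/

section SeriesCase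

variable {F₁ F₂ : Finset (Sym2 V)} {x m y : V}

/-- Series case, a mark at the junction `m`: the other two marks on different blocks ⇒ `m` separates them (`FK.spGood_cutS`);
on the same block ⇒ the other block hangs at the mark `m` (`FK.spGood_oneSided` + the induction hypothesis on the block).
[cite: AyyerLinussonRavichandran2025, §7 (p. 22)] -/
theorem ser_junction {p q : V} (hF₁ : IsTTSP F₁ x m) (hF₂ : IsTTSP F₂ m y) (hdF : Disjoint F₁ F₂)
    (hVF : ∀ z : V, (∃ e ∈ F₁, z ∈ e) → (∃ e ∈ F₂, z ∈ e) → z = m)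
    (ih₁ : ∀ {b s t : V}, (∃ e ∈ F₁, b ∈ e) → (∃ e ∈ F₁, s ∈ e) → (∃ e ∈ F₁, t ∈ e) → b ≠ s → b ≠ t → s ≠ t →
      SPGood F₁ b s t)
    (ih₂ : ∀ {b s t : V}, (∃ e ∈ F₂, b ∈ e) → (∃ e ∈ F₂, s ∈ e) → (∃ e ∈ F₂, t ∈ e) → b ≠ s → b ≠ t → s ≠ t →
      SPGood F₂ b s t)
    (hp : ∃ e ∈ F₁ ∪ F₂, p ∈ e) (hq : ∃ e ∈ F₁ ∪ F₂, q ∈ e) (hpm : p ≠ m) (hqm : q ≠ m) (hpq : p ≠ q) :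
    SPGood (F₁ ∪ F₂) m p q := by
  have hVF' : ∀ z : V, (∃ e ∈ F₂, z ∈ e) → (∃ e ∈ F₁, z ∈ e) → z = m := fun z h2 h1 => hVF z h1 h2
  rcases span_union hp with hp1 | hp2 <;> rcases span_union hq with hq1 | hq2
  · exact spGood_oneSided hdF hVF hF₁.right_mem hp1 hq1 (Ne.symm hpm) (Ne.symm hqm) hpq
      (ih₁ hF₁.right_mem hp1 hq1 (Ne.symm hpm) (Ne.symm hqm) hpq)
  · exact (spGood_cutS hdF hVF hp1 hq2 hpm hqm).rotate'
  · exact (spGood_cutS hdF hVF hq1 hp2 hqm hpm).swap13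
  · exact (spGood_oneSided hdF.symm hVF' hF₂.left_mem hp2 hq2 (Ne.symm hpm) (Ne.symm hqm) hpq
      (ih₂ hF₂.left_mem hp2 hq2 (Ne.symm hpm) (Ne.symm hqm) hpq)).congr_edges (Finset.union_comm _ _)

/-- Series case, junction unmarked, marks `p, q` on the first block and `r` on the second: one-vertex gluing at the unmarked `m`
(`FK.spGood_cut1` + the induction hypothesis on the first block read on `(p, m, q)`). [cite: AyyerLinussonRavichandran2025, §7 (p. 22)] -/
theorem ser_cut1 {p q r : V} (hF₁ : IsTTSP F₁ x m) (hdF : Disjoint F₁ F₂)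
    (hVF : ∀ z : V, (∃ e ∈ F₁, z ∈ e) → (∃ e ∈ F₂, z ∈ e) → z = m)
    (ih₁ : ∀ {b s t : V}, (∃ e ∈ F₁, b ∈ e) → (∃ e ∈ F₁, s ∈ e) → (∃ e ∈ F₁, t ∈ e) → b ≠ s → b ≠ t → s ≠ t →
      SPGood F₁ b s t)
    (hp : ∃ e ∈ F₁, p ∈ e) (hq : ∃ e ∈ F₁, q ∈ e) (hr : ∃ e ∈ F₂, r ∈ e) (hpm : p ≠ m) (hqm : q ≠ m) (hrm : r ≠ m)
    (hpq : p ≠ q) : SPGood (F₁ ∪ F₂) p r q :=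
  spGood_cut1 hdF hVF hp hq hr hpm hqm hrm (ih₁ hp hF₁.right_mem hq hpm hpq (Ne.symm hqm))

/-- **THE SERIES CASE** of the main induction: every placement of three distinct marks on `F₁ ·ₘ F₂` is good, given the
conclusion on each block. [cite: AyyerLinussonRavichandran2025, §7 (p. 22)] -/
theorem spGood_series {b s t : V} (hF₁ : IsTTSP F₁ x m) (hF₂ : IsTTSP F₂ m y) (hdF : Disjoint F₁ F₂)
    (hVF : ∀ z : V, (∃ e ∈ F₁, z ∈ e) → (∃ e ∈ F₂, z ∈ e) → z = m)
    (ih₁ : ∀ {b s t : V}, (∃ e ∈ F₁, b ∈ e) → (∃ e ∈ F₁, s ∈ e) → (∃ e ∈ F₁, t ∈ e) → b ≠ s → b ≠ t → s ≠ t →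
      SPGood F₁ b s t)
    (ih₂ : ∀ {b s t : V}, (∃ e ∈ F₂, b ∈ e) → (∃ e ∈ F₂, s ∈ e) → (∃ e ∈ F₂, t ∈ e) → b ≠ s → b ≠ t → s ≠ t →
      SPGood F₂ b s t)
    (hb : ∃ e ∈ F₁ ∪ F₂, b ∈ e) (hs : ∃ e ∈ F₁ ∪ F₂, s ∈ e) (ht : ∃ e ∈ F₁ ∪ F₂, t ∈ e)
    (hbs : b ≠ s) (hbt : b ≠ t) (hst : s ≠ t) : SPGood (F₁ ∪ F₂) b s t := by
  by_cases hbm : b = m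
  · subst hbm
    exact ser_junction hF₁ hF₂ hdF hVF ih₁ ih₂ hs ht (Ne.symm hbs) (Ne.symm hbt) hst
  by_cases hsm : s = m
  · subst hsm
    exact (ser_junction hF₁ hF₂ hdF hVF ih₁ ih₂ hb ht hbs (Ne.symm hst) hbt).swap12
  by_cases htm : t = m
  · subst htm
    exact (ser_junction hF₁ hF₂ hdF hVF ih₁ ih₂ hb hs hbt hst hbs).rotate
  have hVF' : ∀ z : V, (∃ e ∈ F₂, z ∈ e) → (∃ e ∈ F₁, z ∈ e) → z = m := fun z h2 h1 => hVF z h1 h2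
  have eB : F₂ ∪ F₁ = F₁ ∪ F₂ := Finset.union_comm _ _
  rcases span_union hb with hb1 | hb2 <;> rcases span_union hs with hs1 | hs2 <;> rcases span_union ht with ht1 | ht2
  · exact spGood_oneSided hdF hVF hb1 hs1 ht1 hbs hbt hst (ih₁ hb1 hs1 ht1 hbs hbt hst)
  · exact (ser_cut1 hF₁ hdF hVF ih₁ hb1 hs1 ht2 hbm hsm htm hbs).swap23
  · exact ser_cut1 hF₁ hdF hVF ih₁ hb1 ht1 hs2 hbm htm hsm hbt
  · exact (ser_cut1 hF₂.symm hdF.symm hVF' ih₂ hs2 ht2 hb1 hsm htm hbm hst).swap12.congr_edges eB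
  · exact (ser_cut1 hF₁ hdF hVF ih₁ hs1 ht1 hb2 hsm htm hbm hst).swap12
  · exact (ser_cut1 hF₂.symm hdF.symm hVF' ih₂ hb2 ht2 hs1 hbm htm hsm hbt).congr_edges eB
  · exact (ser_cut1 hF₂.symm hdF.symm hVF' ih₂ hb2 hs2 ht1 hbm hsm htm hbs).swap23.congr_edges eB
  · exact (spGood_oneSided hdF.symm hVF' hb2 hs2 ht2 hbs hbt hst (ih₂ hb2 hs2 ht2 hbs hbt hst)).congr_edges eB

end SeriesCase

/-! ### THEOREM SP -/

section Main

/-- THEOREM SP by strong induction on the number of edges (auxiliary form with an explicit bound).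
[cite: AyyerLinussonRavichandran2025, §7 (p. 22)] -/
theorem spGood_of_isTTSP_aux : ∀ (n : ℕ) {E : Finset (Sym2 V)} {x y b s t : V}, E.card ≤ n → IsTTSP E x y →
    (∃ e ∈ E, b ∈ e) → (∃ e ∈ E, s ∈ e) → (∃ e ∈ E, t ∈ e) → b ≠ s → b ≠ t → s ≠ t → SPGood E b s t := by
  intro n
  induction n with
  | zero =>
    intro E x y b s t hcard hE _ _ _ _ _ _
    have := hE.card_pos
    omega
  | succ n ih =>
    intro E x y b s t hcard hE hb hs ht hbs hbt hst
    cases hE with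
    | edge hxy =>
      have key : ∀ p : V, (∃ e ∈ ({s(x, y)} : Finset (Sym2 V)), p ∈ e) → p = x ∨ p = y := fun p ⟨e, he, hpe⟩ => by
        rw [Finset.mem_singleton] at he
        subst he
        exact Sym2.mem_iff.1 hpe
      rcases key b hb with hb' | hb' <;> rcases key s hs with hs' | hs' <;> rcases key t ht with ht' | ht'
      all_goals first
        | exact absurd (hb'.trans hs'.symm) hbs
        | exact absurd (hb'.trans ht'.symm) hbt
        | exact absurd (hs'.trans ht'.symm) hst
    | @parallel Q₁ Q₂ _ _ hQ₁ hQ₂ hdQ hVQ => exact spGood_parallel hQ₁ hQ₂ hdQ hVQ hb hs ht hbs hbt hst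
    | @series F₁ F₂ _ m _ hF₁ hF₂ hdF hVF hxF₂ hyF₁ =>
      have hlt1 := card_left_lt_of_parallel hF₂ hdF
      have hlt2 := card_right_lt_of_parallel hF₁ hdF
      exact spGood_series hF₁ hF₂ hdF hVF
        (fun hb' hs' ht' hbs' hbt' hst' => ih (by omega) hF₁ hb' hs' ht' hbs' hbt' hst')
        (fun hb' hs' ht' hbs' hbt' hst' => ih (by omega) hF₂ hb' hs' ht' hbs' hbt' hst') hb hs ht hbs hbt hst

/-- **THEOREM SP ON TWO-TERMINAL SERIES–PARALLEL NETWORKS, EVERY PLACEMENT** (census g34's house result, kernel form census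
g36/g37): for a two-terminal series–parallel network `E` and ANY three pairwise distinct vertices `b, s, t` on `E`, `T_sym(b,s,t) ≥ 0`
and `STAR(b;s,t), STAR(s;b,t), STAR(t;b,s) ≥ 0` at every level. [cite: AyyerLinussonRavichandran2025, §7 (p. 22)] -/
theorem spGood_of_isTTSP {E : Finset (Sym2 V)} {x y b s t : V} (hE : IsTTSP E x y) (hb : ∃ e ∈ E, b ∈ e)
    (hs : ∃ e ∈ E, s ∈ e) (ht : ∃ e ∈ E, t ∈ e) (hbs : b ≠ s) (hbt : b ≠ t) (hst : s ≠ t) : SPGood E b s t :=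
  spGood_of_isTTSP_aux E.card le_rfl hE hb hs ht hbs hbt hst

/-- **THEOREM SP, levelwise form spelled out**: `T_sym` and the three `STAR`s are levelwise nonnegative.
[cite: AyyerLinussonRavichandran2025, §7 (p. 22)] -/
theorem sp_levelwise_nonneg {E : Finset (Sym2 V)} {x y b s t : V} (hE : IsTTSP E x y) (hb : ∃ e ∈ E, b ∈ e)
    (hs : ∃ e ∈ E, s ∈ e) (ht : ∃ e ∈ E, t ∈ e) (hbs : b ≠ s) (hbt : b ≠ t) (hst : s ≠ t) (μ : ℕ) :
    0 ≤ lev2 E b s t tsym2Tab μ ∧ 0 ≤ lev2 E b s t starXTab μ ∧ 0 ≤ lev2 E b s t (mirror2 starXTab) μ ∧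
      0 ≤ lev2 E b s t starSTab μ :=
  spGood_of_isTTSP hE hb hs ht hbs hbt hst μ

/-- **THEOREM SP, weight form for `T_sym`**: `0 ≤ tval w E b s t T_sym` for every nonnegative level weight, every placement of
three distinct marks on a two-terminal series–parallel network. [cite: AyyerLinussonRavichandran2025, §7 (p. 22)] -/
theorem tval_tsym_nonneg_of_isTTSP {E : Finset (Sym2 V)} {x y b s t : V} (hE : IsTTSP E x y) (hb : ∃ e ∈ E, b ∈ e)
    (hs : ∃ e ∈ E, s ∈ e) (ht : ∃ e ∈ E, t ∈ e) (hbs : b ≠ s) (hbt : b ≠ t) (hst : s ≠ t) {w : ℕ → ℝ}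
    (hw : ∀ n, 0 ≤ w n) : 0 ≤ tval w E b s t tsymTab :=
  tval_tsym_nonneg_of_lev2 Nat.one_pos (fun μ => by simpa using (spGood_of_isTTSP hE hb hs ht hbs hbt hst μ).1) hw

/-- **THEOREM SP, weight form for `STAR`** (apex = the first listed mark; the other apexes by permuting the hypotheses):
`0 ≤ mval2 w E b s t starXTab` for every nonnegative weight. [cite: AyyerLinussonRavichandran2025, §7 (p. 22)] -/
theorem mval2_star_nonneg_of_isTTSP {E : Finset (Sym2 V)} {x y b s t : V} (hE : IsTTSP E x y) (hb : ∃ e ∈ E, b ∈ e)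
    (hs : ∃ e ∈ E, s ∈ e) (ht : ∃ e ∈ E, t ∈ e) (hbs : b ≠ s) (hbt : b ≠ t) (hst : s ≠ t) {w : ℕ → ℝ}
    (hw : ∀ n, 0 ≤ w n) : 0 ≤ mval2 w E b s t starXTab :=
  ((spGood_of_isTTSP hE hb hs ht hbs hbt hst).mval2_nonneg hw).2.1

/-- **NEW KERNEL ROW (census g37): CONJECTURE T FOR EVERY PLACEMENT ON EVERY TWO-TERMINAL SERIES–PARALLEL NETWORK.**
For `q > 0`, a two-terminal series–parallel network `E` and any three pairwise distinct vertices `b, s, t` on `E`: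
`0 ≤ antipodalT q b s t E ∅`, i.e. `δ(b; s, t) ≥ 0` in the lane's antipodal dictionary (`AntipodalTPos`'s functional) — the apex
and the pair are arbitrary.  (Before: pair = the two terminals, fk-2's `FK.antipodalT_nonneg_of_isTTSP`; apex a terminal and pair =
{terminal, inner}, census g36; THETA/RING/CORNER/separating-mark rows, census g36.) [cite: AyyerLinussonRavichandran2025, §7 eq. (13)–(15) (p. 22)] -/
theorem antipodalT_nonneg_of_isTTSP_marks {q : ℝ} (hq : 0 < q) {E : Finset (Sym2 V)} {x y b s t : V} (hE : IsTTSP E x y)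
    (hb : ∃ e ∈ E, b ∈ e) (hs : ∃ e ∈ E, s ∈ e) (ht : ∃ e ∈ E, t ∈ e) (hbs : b ≠ s) (hbt : b ≠ t) (hst : s ≠ t) :
    0 ≤ antipodalT q b s t (↑E : BondConfig V) ∅ := by
  have hw : ∀ n, 0 ≤ (fun n => q ^ n) n := fun n => pow_nonneg hq.le n
  rw [antipodalT_eq_tval]
  exact (tval_tsym_nonneg_of_isTTSP hE hb hs ht hbs hbt hst hw).trans (tval_mono tsymTab_le_tApexTab hw)

end Main

end FK

end Summit.CriticalPhenomena.PercolationContinuityZ3.Theorems
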